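import Mathlib.Tactic.Ring
import Mathlib.Tactic.Linarith
import HarnessLib

/-!
# Venture HSemireg — the COVER LEMMA behind THEOREM H-FOOT: footprints of the four shapes that cover a balanced rectangle force a slot-1 + slot-2 decomposition

Companion to `AdditiveCrossDecomposition.lean` (H-CROSS; v2 §2 «footprint connectivity», §3 «class death per rectangle»),
`AdditiveNetClassDeath.lean` (H-NET, k = 251), `NetPropagation.lean` (k = 252) and `LayerBlocks.lean` (k = 269) — cell pub-hsemireg,
seat p2 gen 16, note `p2/wlaws/GLUING16-p2g16.md` §6 «THEOREM H-FOOT», bus G16-RESULT 1.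

SETTING (there).  Fix a sloped slot-3 line `m` and a linked rectangle `D × C` of its Weil layer (THEOREM (LAYER BLOCKS));
rows `r ∈ D` and columns `c ∈ C` are sloped lines with directions `sR r`, `sC c` in the three-element set of sloped
directions (cube alphabet).  At a doubly-footed curve of `(r, c)` the crossed partner `(x, y)` has its lines outside `D`, `C`,
and by (X·A′) ∕ (X·A) every crossing of `x` with a row and of `y` with a column is a foot with the same partner, so the
2 × 2 interactions of an additive weighting `w` vanish on the FOOTPRINT «rows not parallel to `x`» × «columns not parallel to
`y`» (`AdditiveCrossDecomposition.interaction_eq_zero`).  A footprint therefore has one of four SHAPES, recorded here as a pair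
`(oσ, oτ) : Option S × Option S`: `some σ` = «all rows of direction ≠ σ» (sloped partner line of direction `σ`), `none` = «all
rows» (axis partner line); likewise for columns.  The support-side facts of the note's proof are the three hypotheses
`cover` (every cell lies in a footprint: (rows) + (A·A′)), `closure` (one sloped–sloped partner is a Weil pair of an unlinked
balanced rectangle `D* × C*`, whose other lines are again partners: LAYER BLOCKS (b)(c) + (X·A′), so ALL nine sloped–sloped
shapes occur) and `balR` ∕ `balC` (the blocks `D`, `C` contain all three directions: THEOREM F's tier), plus `three` (a third
direction always exists).

THIS FILE is the kernel form of the combinatorial step: under these hypotheses EVERY 2 × 2 interaction of `w` on `D × C`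
vanishes (`interaction_zero_of_cover`), hence `w r c = f r + g c` (`exists_row_add_col_of_cover`) — the hypothesis of
`AdditiveCrossDecomposition.rect_class_dead` ∕ `AdditiveNetClassDeath.net_class_dead`, so with balanced blocks «additive ⇒
class-dead» follows on every such rectangle with NO net, axis or cross-feet hypothesis (THEOREM H-FOOT).  The proof is the
note's case analysis: a sloped–sloped footprint gives all nine, and any two rows and two columns avoid some third directions;
otherwise either the net shape occurs, or two row-shapes (or two column-shapes) of different directions occur and the rows
connect through a row of the third direction (the interaction is a cocycle), or the cell of the two missing directions would be
uncovered.
What the kernel certifies: this bookkeeping; what it does not: that a given support satisfies (rows), (A·A′), (X·A′), the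
LAYER BLOCKS facts or balance (hand ∕ catalogue, note §6).

HONEST FRAMING. Finite bookkeeping over the integers; no variety, cycle, cohomology class or semiregularity map occurs; nothing
here bears on HC ∕ HC_CM ∕ HC_AV.
-/

namespace Summit.Ventures.HSemireg
namespace AdditiveFootprintCover

variable {R C S : Type*}

/-- **All interactions vanish.**  Rows `R`, columns `C` with direction maps `sR`, `sC` into `S`; `Φ oσ oτ` says that the
footprint of shape `(oσ, oτ)` is present, i.e. (`wit`) the 2 × 2 interaction of `w` vanishes on all rows allowed by `oσ`
(`none`: all rows; `some σ`: rows of direction `≠ σ`) times all columns allowed by `oτ`.  If every cell is covered by a present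
shape (`cover`), one sloped–sloped shape forces all of them (`closure`), every two directions admit a third (`three`) and every
direction occurs among the rows and among the columns (`balR`, `balC`), then every 2 × 2 interaction of `w` vanishes. -/
theorem interaction_zero_of_cover (sR : R → S) (sC : C → S) (w : R → C → ℤ) (Φ : Option S → Option S → Prop)
    (wit : ∀ oσ oτ, Φ oσ oτ → ∀ (r r' : R) (c c' : C),
      (∀ σ, oσ = some σ → sR r ≠ σ) → (∀ σ, oσ = some σ → sR r' ≠ σ) →
      (∀ τ, oτ = some τ → sC c ≠ τ) → (∀ τ, oτ = some τ → sC c' ≠ τ) →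
      w r c - w r c' - w r' c + w r' c' = 0)
    (cover : ∀ r c, ∃ oσ oτ, Φ oσ oτ ∧ (∀ σ, oσ = some σ → sR r ≠ σ) ∧ (∀ τ, oτ = some τ → sC c ≠ τ))
    (closure : (∃ σ τ, Φ (some σ) (some τ)) → ∀ σ τ, Φ (some σ) (some τ))
    (three : ∀ i j : S, ∃ k, k ≠ i ∧ k ≠ j)
    (balR : ∀ s, ∃ r, sR r = s) (balC : ∀ s, ∃ c, sC c = s)
    (r r' : R) (c c' : C) : w r c - w r c' - w r' c + w r' c' = 0 := by
  classical
  -- the two one-sided shapes, unpacked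
  have hL : ∀ σ, Φ (some σ) none → ∀ (x x' : R) (y y' : C), sR x ≠ σ → sR x' ≠ σ →
      w x y - w x y' - w x' y + w x' y' = 0 := fun σ h x x' y y' hx hx' =>
    wit (some σ) none h x x' y y' (fun σ' e => by cases e; exact hx) (fun σ' e => by cases e; exact hx')
      (fun τ e => by cases e) (fun τ e => by cases e)
  have hR : ∀ τ, Φ none (some τ) → ∀ (x x' : R) (y y' : C), sC y ≠ τ → sC y' ≠ τ →
      w x y - w x y' - w x' y + w x' y' = 0 := fun τ h x x' y y' hy hy' =>
    wit none (some τ) h x x' y y' (fun σ e => by cases e) (fun σ e => by cases e)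
      (fun τ' e => by cases e; exact hy) (fun τ' e => by cases e; exact hy')
  by_cases hA : ∃ σ τ, Φ (some σ) (some τ)
  · -- Case A: all nine sloped–sloped shapes; avoid a third direction on each side
    obtain ⟨k, hk, hk'⟩ := three (sR r) (sR r')
    obtain ⟨l, hl, hl'⟩ := three (sC c) (sC c')
    exact wit (some k) (some l) (closure hA k l) r r' c c'
      (fun σ e => by cases e; exact fun h => hk h.symm) (fun σ e => by cases e; exact fun h => hk' h.symm)
      (fun τ e => by cases e; exact fun h => hl h.symm) (fun τ e => by cases e; exact fun h => hl' h.symm)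
  · by_cases hN : Φ none none
    · -- a net: one footprint is everything
      exact wit none none hN r r' c c' (fun σ e => by cases e) (fun σ e => by cases e)
        (fun τ e => by cases e) (fun τ e => by cases e)
    · by_cases hL2 : ∃ σ₁ σ₂, σ₁ ≠ σ₂ ∧ Φ (some σ₁) none ∧ Φ (some σ₂) none
      · -- Case B1: two row-shapes of different directions; connect through a row of a third direction
        obtain ⟨σ₁, σ₂, hne, h₁, h₂⟩ := hL2
        obtain ⟨k, hk₁, hk₂⟩ := three σ₁ σ₂
        obtain ⟨r'', hr''⟩ := balR k
        have step : ∀ x, w x c - w x c' - w r'' c + w r'' c' = 0 := by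
          intro x
          by_cases hx : sR x = σ₁
          · exact hL σ₂ h₂ x r'' c c' (by rw [hx]; exact hne) (by rw [hr'']; exact hk₂)
          · exact hL σ₁ h₁ x r'' c c' hx (by rw [hr'']; exact hk₁)
        have e₁ := step r
        have e₂ := step r'
        linarith
      · by_cases hR2 : ∃ τ₁ τ₂, τ₁ ≠ τ₂ ∧ Φ none (some τ₁) ∧ Φ none (some τ₂)
        · -- Case B2: the same with columns
          obtain ⟨τ₁, τ₂, hne, h₁, h₂⟩ := hR2
          obtain ⟨l, hl₁, hl₂⟩ := three τ₁ τ₂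
          obtain ⟨c'', hc''⟩ := balC l
          have step : ∀ y, w r y - w r c'' - w r' y + w r' c'' = 0 := by
            intro y
            by_cases hy : sC y = τ₁
            · exact hR τ₂ h₂ r r' y c'' (by rw [hy]; exact hne) (by rw [hc'']; exact hl₂)
            · exact hR τ₁ h₁ r r' y c'' hy (by rw [hc'']; exact hl₁)
          have e₁ := step c
          have e₂ := step c'
          linarith
        · -- Case B3: at most one row-shape and one column-shape direction — some cell is uncovered
          exfalso
          -- a row and a column to test `cover` on
          have pick : ∃ r₀ c₀, (∀ σ, Φ (some σ) none → sR r₀ = σ) ∧ (∀ τ, Φ none (some τ) → sC c₀ = τ) := by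
            by_cases hL1 : ∃ σ, Φ (some σ) none
            · obtain ⟨σ, hσ⟩ := hL1
              obtain ⟨r₀, hr₀⟩ := balR σ
              have hrow : ∀ σ', Φ (some σ') none → sR r₀ = σ' := by
                intro σ' hσ'
                by_contra hneq
                exact hL2 ⟨σ', σ, fun h => hneq (hr₀.trans h.symm), hσ', hσ⟩
              by_cases hR1 : ∃ τ, Φ none (some τ)
              · obtain ⟨τ, hτ⟩ := hR1
                obtain ⟨c₀, hc₀⟩ := balC τ
                refine ⟨r₀, c₀, hrow, fun τ' hτ' => ?_⟩
                by_contra hneq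
                exact hR2 ⟨τ', τ, fun h => hneq (hc₀.trans h.symm), hτ', hτ⟩
              · exact ⟨r₀, c, hrow, fun τ' hτ' => (hR1 ⟨τ', hτ'⟩).elim⟩
            · have hrow : ∀ σ', Φ (some σ') none → sR r = σ' := fun σ' hσ' => (hL1 ⟨σ', hσ'⟩).elim
              by_cases hR1 : ∃ τ, Φ none (some τ)
              · obtain ⟨τ, hτ⟩ := hR1
                obtain ⟨c₀, hc₀⟩ := balC τ
                refine ⟨r, c₀, hrow, fun τ' hτ' => ?_⟩
                by_contra hneq
                exact hR2 ⟨τ', τ, fun h => hneq (hc₀.trans h.symm), hτ', hτ⟩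
              · exact ⟨r, c, hrow, fun τ' hτ' => (hR1 ⟨τ', hτ'⟩).elim⟩
          obtain ⟨r₀, c₀, hrow, hcol⟩ := pick
          obtain ⟨oσ, oτ, hΦ, hcr, hcc⟩ := cover r₀ c₀
          cases oσ with
          | none =>
            cases oτ with
            | none => exact hN hΦ
            | some τ' => exact hcc τ' rfl (hcol τ' hΦ)
          | some σ' =>
            cases oτ with
            | none => exact hcr σ' rfl (hrow σ' hΦ)
            | some τ' => exact hA ⟨σ', τ', hΦ⟩

/-- **THE COVER LEMMA (decomposition).**  Under the hypotheses of `interaction_zero_of_cover` the weight on the rectangle is a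
sum of a row term and a column term, `w r c = f r + g c` — the hypothesis «decomposition» of
`AdditiveCrossDecomposition.rect_class_dead` and of `AdditiveNetClassDeath.net_class_dead`; with balanced blocks, «additive ⇒
class-dead» on the rectangle follows (THEOREM H-FOOT of the note, whose incidence steps supply `wit`, `cover`, `closure`). -/
theorem exists_row_add_col_of_cover (sR : R → S) (sC : C → S) (w : R → C → ℤ) (Φ : Option S → Option S → Prop)
    (wit : ∀ oσ oτ, Φ oσ oτ → ∀ (r r' : R) (c c' : C),
      (∀ σ, oσ = some σ → sR r ≠ σ) → (∀ σ, oσ = some σ → sR r' ≠ σ) →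
      (∀ τ, oτ = some τ → sC c ≠ τ) → (∀ τ, oτ = some τ → sC c' ≠ τ) →
      w r c - w r c' - w r' c + w r' c' = 0)
    (cover : ∀ r c, ∃ oσ oτ, Φ oσ oτ ∧ (∀ σ, oσ = some σ → sR r ≠ σ) ∧ (∀ τ, oτ = some τ → sC c ≠ τ))
    (closure : (∃ σ τ, Φ (some σ) (some τ)) → ∀ σ τ, Φ (some σ) (some τ))
    (three : ∀ i j : S, ∃ k, k ≠ i ∧ k ≠ j)
    (balR : ∀ s, ∃ r, sR r = s) (balC : ∀ s, ∃ c, sC c = s) :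
    ∃ f : R → ℤ, ∃ g : C → ℤ, ∀ r c, w r c = f r + g c := by
  classical
  have hZ := interaction_zero_of_cover sR sC w Φ wit cover closure three balR balC
  by_cases hRn : Nonempty R
  · by_cases hCn : Nonempty C
    · obtain ⟨r₀⟩ := hRn
      obtain ⟨c₀⟩ := hCn
      refine ⟨fun r => w r c₀, fun c => w r₀ c - w r₀ c₀, fun r c => ?_⟩
      have h := hZ r r₀ c c₀
      linarith
    · exact ⟨fun _ => 0, fun _ => 0, fun r c => (hCn ⟨c⟩).elim⟩
  · exact ⟨fun _ => 0, fun _ => 0, fun r c => (hRn ⟨r⟩).elim⟩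

end AdditiveFootprintCover
end Summit.Ventures.HSemireg
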